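import Summits.NavierStokesRegularity.NavierStokesRegularity.Theorems.FilamentSkeletonRssKelvinGateClosingPicard

/-!
# Route `FilamentSkeletonRss` · line family `kelvin_gate` / `defect_column_gate_*` — the Y-SCALE CONTRACTION PRINCIPLE (abstracted from the Picard file)

Helper file (theorems only), `--supports stmt-NavierStokesRegularity-23611 --as helper`; LEAD of 23611, lane ns-filament-21221-p1 g13.

`KelvinGate.picard_exists_fixedPoint` (p5xx, `…KelvinGateClosingPicard`) proves the existence of the fixed-point forcing of ONE specific map
`F ↦ −r − D(KF)[KF]` by Picard iteration, with the limit construction (pointwise geometric Cauchy sequences in `ℝ³` and `ℝ³ →L ℝ³`, `C¹` limit by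
`hasFDerivAt_of_tendstoUniformly`, weighted bounds passing to the limit) INLINED.  The A1R-acc line needs the same principle twice more — for the LINEAR
fixed point `F′ = F + R F′` that turns an approximate bordered right inverse into an exact one (S2b-acc assembly, «bordered Neumann series»), and for
parametric versions — so this file ABSTRACTS it once:

* `yLimit_of_geometric` — a sequence of `C¹` fields with a uniform Y-bound `M` and geometric Y-increments `2ε/2ⁿ` has a Y-bounded `C¹` limit `F_∞`
  (`Y(F_∞) ≤ M`, `Y(F_n − F_∞) ≤ 4ε(1/2)ⁿ`), with pointwise convergence of values and derivatives;
* `yContraction_exists_fixedPoint` — a self-map `Φ` of the Y-ball of radius `M ≥ 0` that HALVES Y-distances has a fixed point in the ball;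
* `yContraction_unique` — and only one.

HONEST FRAMING: elementary fixed-point bookkeeping in the weighted `C¹` scale of a HYPOTHETICAL blow-up route's gate vocabulary (MODEL rung, negative side);
nothing here bears on Navier–Stokes regularity.
-/

set_option linter.dupNamespace false

noncomputable section

namespace Summit.NavierStokesRegularity.NavierStokesRegularity.Theorems.KelvinGate

open Set Function Filter Topology
open Literature.Analysis.FluidPDE
open scoped InnerProductSpace ContDiff Topology

/-- **Y-scale limit of a geometric sequence.**  `F_n ∈ C¹` with `Y(F_n) ≤ M` and `Y(F_{n+1} − F_n) ≤ 2ε/2ⁿ`: there is `F_∞ ∈ C¹` with `Y(F_∞) ≤ M`,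
`Y(F_n − F_∞) ≤ 4ε·(1/2)ⁿ`, and `F_n → F_∞`, `DF_n → DF_∞` pointwise. -/
theorem yLimit_of_geometric {Fs : ℕ → EuclideanSpace ℝ (Fin 3) → EuclideanSpace ℝ (Fin 3)} {M ε : ℝ}
    (hb : ∀ n, YBound (Fs n) M) (hd : ∀ n, YBound (fun y => Fs (n + 1) y - Fs n y) (2 * ε / 2 ^ n)) :
    ∃ Flim : EuclideanSpace ℝ (Fin 3) → EuclideanSpace ℝ (Fin 3), YBound Flim M ∧
      (∀ n, YBound (fun y => Fs n y - Flim y) (4 * ε * (1 / 2) ^ n)) ∧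
      (∀ y, Tendsto (fun n => Fs n y) atTop (𝓝 (Flim y))) ∧ (∀ y, Tendsto (fun n => fderiv ℝ (Fs n) y) atTop (𝓝 (fderiv ℝ Flim y))) := by
  have hC1s : ∀ n, ContDiff ℝ 1 (Fs n) := fun n => (hb n).1
  have hdiff : ∀ n y, DifferentiableAt ℝ (Fs n) y := fun n y => (hC1s n).differentiable (by norm_num) y
  have h2n : ∀ n : ℕ, (2:ℝ) * ε / 2 ^ n = 2 * ε * (1 / 2) ^ n := fun n => by
    rw [one_div, inv_pow, div_eq_mul_inv]
  -- weighted geometric increments, for the fields and for their derivatives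
  have hdist : ∀ y n, dist (Fs n y) (Fs (n + 1) y) ≤ 2 * ε / (1 + ‖y‖) ^ 2 * (1 / 2) ^ n := by
    intro y n
    rw [dist_comm, dist_eq_norm]
    have h := (hd n).norm_le y
    rw [h2n] at h
    calc ‖Fs (n + 1) y - Fs n y‖ ≤ 2 * ε * (1 / 2) ^ n / (1 + ‖y‖) ^ 2 := h
      _ = 2 * ε / (1 + ‖y‖) ^ 2 * (1 / 2) ^ n := by ring
  have hdistD : ∀ y n, dist (fderiv ℝ (Fs n) y) (fderiv ℝ (Fs (n + 1)) y) ≤ 2 * ε / (1 + ‖y‖) ^ 2 * (1 / 2) ^ n := by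
    intro y n
    rw [dist_comm, dist_eq_norm]
    have h := ((hd n).2 y).2
    rw [fderiv_fun_sub (hdiff (n + 1) y) (hdiff n y), h2n] at h
    have e : 2 * ε / (1 + ‖y‖) ^ 2 * (1 / 2 : ℝ) ^ n = 2 * ε * (1 / 2) ^ n / (1 + ‖y‖) ^ 2 := by ring
    rw [e, le_div_iff₀ (by positivity)]
    calc ‖fderiv ℝ (Fs (n + 1)) y - fderiv ℝ (Fs n) y‖ * (1 + ‖y‖) ^ 2
        = (1 + ‖y‖) ^ 2 * ‖fderiv ℝ (Fs (n + 1)) y - fderiv ℝ (Fs n) y‖ := by ring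
      _ ≤ 2 * ε * (1 / 2) ^ n := h
  -- pointwise limits (values in `ℝ³`, derivatives in `ℝ³ →L ℝ³`; both complete)
  have hlimF : ∀ y, ∃ v, Tendsto (fun n => Fs n y) atTop (𝓝 v) := fun y =>
    cauchySeq_tendsto_of_complete (cauchySeq_of_le_geometric (1 / 2) _ (by norm_num) (hdist y))
  have hlimD : ∀ y, ∃ L, Tendsto (fun n => fderiv ℝ (Fs n) y) atTop (𝓝 L) := fun y =>
    cauchySeq_tendsto_of_complete (cauchySeq_of_le_geometric (1 / 2) _ (by norm_num) (hdistD y))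
  choose Flim hFlim using hlimF
  choose Glim hGlim using hlimD
  -- geometric tails
  have htail : ∀ y n, dist (Fs n y) (Flim y) ≤ 4 * ε / (1 + ‖y‖) ^ 2 * (1 / 2) ^ n := by
    intro y n
    have h := dist_le_of_le_geometric_of_tendsto (1 / 2) _ (by norm_num) (hdist y) (hFlim y) n
    calc dist (Fs n y) (Flim y) ≤ 2 * ε / (1 + ‖y‖) ^ 2 * (1 / 2) ^ n / (1 - 1 / 2) := h
      _ = 4 * ε / (1 + ‖y‖) ^ 2 * (1 / 2) ^ n := by ring
  have htailD : ∀ y n, dist (fderiv ℝ (Fs n) y) (Glim y) ≤ 4 * ε / (1 + ‖y‖) ^ 2 * (1 / 2) ^ n := by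
    intro y n
    have h := dist_le_of_le_geometric_of_tendsto (1 / 2) _ (by norm_num) (hdistD y) (hGlim y) n
    calc dist (fderiv ℝ (Fs n) y) (Glim y) ≤ 2 * ε / (1 + ‖y‖) ^ 2 * (1 / 2) ^ n / (1 - 1 / 2) := h
      _ = 4 * ε / (1 + ‖y‖) ^ 2 * (1 / 2) ^ n := by ring
  -- `0 ≤ ε` unless the sequence is constant; in all cases `4ε(1/2)ⁿ ≥ 0` is what we need, from `Y(F₁ − F₀) ≥ 0`
  have hε : 0 ≤ ε := by
    have h := (hd 0).nonneg
    simp only [pow_zero, div_one] at h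
    linarith
  -- the derivatives converge uniformly (the weight is `≥ 1`)
  have hpow0 : Tendsto (fun n : ℕ => 4 * ε * (1 / 2 : ℝ) ^ n) atTop (𝓝 0) := by
    have h := (tendsto_pow_atTop_nhds_zero_of_lt_one (by norm_num : (0:ℝ) ≤ 1 / 2)
      (by norm_num : (1 / 2 : ℝ) < 1)).const_mul (4 * ε)
    rwa [mul_zero] at h
  have hunif : TendstoUniformly (fun n y => fderiv ℝ (Fs n) y) Glim atTop := by
    rw [Metric.tendstoUniformly_iff]
    intro δ hδ
    filter_upwards [(hpow0.eventually (gt_mem_nhds hδ))] with n hn y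
    rw [dist_comm]
    have hw : (1:ℝ) ≤ (1 + ‖y‖) ^ 2 := by nlinarith [norm_nonneg y]
    calc dist (fderiv ℝ (Fs n) y) (Glim y) ≤ 4 * ε / (1 + ‖y‖) ^ 2 * (1 / 2) ^ n := htailD y n
      _ ≤ 4 * ε / 1 * (1 / 2) ^ n := by
          gcongr
      _ = 4 * ε * (1 / 2) ^ n := by ring
      _ < δ := hn
  -- the limit is `C¹` with derivative `Glim`
  have hderiv : ∀ y, HasFDerivAt Flim (Glim y) y :=
    hasFDerivAt_of_tendstoUniformly hunif (fun n y => (hdiff n y).hasFDerivAt) hFlim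
  have hfd : fderiv ℝ Flim = Glim := funext fun y => (hderiv y).fderiv
  have hC1 : ContDiff ℝ 1 Flim := by
    rw [contDiff_one_iff_fderiv]
    refine ⟨fun y => (hderiv y).differentiableAt, ?_⟩
    rw [hfd]
    exact hunif.continuous (Eventually.of_forall fun n => (hC1s n).continuous_fderiv one_ne_zero).frequently
  -- weighted bounds pass to the limit
  have hYlim : YBound Flim M := by
    refine ⟨hC1, fun y => ⟨?_, ?_⟩⟩
    · refine le_of_tendsto ((hFlim y).norm.const_mul ((1 + ‖y‖) ^ 2)) (Eventually.of_forall fun n => ?_)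
      exact ((hb n).2 y).1
    · rw [hfd]
      refine le_of_tendsto ((hGlim y).norm.const_mul ((1 + ‖y‖) ^ 2)) (Eventually.of_forall fun n => ?_)
      exact ((hb n).2 y).2
  have hYdiff : ∀ n, YBound (fun y => Fs n y - Flim y) (4 * ε * (1 / 2) ^ n) := by
    intro n
    refine ⟨(hC1s n).sub hC1, fun y => ⟨?_, ?_⟩⟩
    · calc (1 + ‖y‖) ^ 2 * ‖Fs n y - Flim y‖ = dist (Fs n y) (Flim y) * (1 + ‖y‖) ^ 2 := by
            rw [dist_eq_norm]; ring
        _ ≤ 4 * ε / (1 + ‖y‖) ^ 2 * (1 / 2) ^ n * (1 + ‖y‖) ^ 2 :=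
            mul_le_mul_of_nonneg_right (htail y n) (by positivity)
        _ = 4 * ε * (1 / 2) ^ n := by field_simp
    · rw [fderiv_fun_sub (hdiff n y) ((hderiv y).differentiableAt), hfd]
      calc (1 + ‖y‖) ^ 2 * ‖fderiv ℝ (Fs n) y - Glim y‖ = dist (fderiv ℝ (Fs n) y) (Glim y) * (1 + ‖y‖) ^ 2 := by
            rw [dist_eq_norm]; ring
        _ ≤ 4 * ε / (1 + ‖y‖) ^ 2 * (1 / 2) ^ n * (1 + ‖y‖) ^ 2 :=
            mul_le_mul_of_nonneg_right (htailD y n) (by positivity)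
        _ = 4 * ε * (1 / 2) ^ n := by field_simp
  refine ⟨Flim, hYlim, hYdiff, hFlim, fun y => ?_⟩
  rw [hfd]; exact hGlim y

/-- Pointwise consequence of a Y-bound tending to zero: if `Y(F_n − G) ≤ c·(1/2)ⁿ` then `F_n(y) → G(y)`. -/
theorem tendsto_of_yBound_geometric {Fs : ℕ → EuclideanSpace ℝ (Fin 3) → EuclideanSpace ℝ (Fin 3)}
    {G : EuclideanSpace ℝ (Fin 3) → EuclideanSpace ℝ (Fin 3)} {c : ℝ} (h : ∀ n, YBound (fun y => Fs n y - G y) (c * (1 / 2) ^ n))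
    (y : EuclideanSpace ℝ (Fin 3)) : Tendsto (fun n => Fs n y) atTop (𝓝 (G y)) := by
  have hpow : Tendsto (fun n : ℕ => c * (1 / 2 : ℝ) ^ n) atTop (𝓝 0) := by
    have h := (tendsto_pow_atTop_nhds_zero_of_lt_one (by norm_num : (0:ℝ) ≤ 1 / 2)
      (by norm_num : (1 / 2 : ℝ) < 1)).const_mul c
    rwa [mul_zero] at h
  rw [tendsto_iff_norm_sub_tendsto_zero]
  refine squeeze_zero (fun n => norm_nonneg _) (fun n => ?_) hpow
  exact ((h n).norm_le' y).1

/-- **Fixed point of a Y-contraction.**  A self-map `Φ` of the Y-ball `{Y ≤ M}` (`M ≥ 0`) that halves Y-distances on the ball has a fixed point in the ball. -/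
theorem yContraction_exists_fixedPoint
    (Φ : (EuclideanSpace ℝ (Fin 3) → EuclideanSpace ℝ (Fin 3)) → EuclideanSpace ℝ (Fin 3) → EuclideanSpace ℝ (Fin 3)) {M : ℝ} (hM : 0 ≤ M)
    (hmaps : ∀ F, YBound F M → YBound (Φ F) M)
    (hcontr : ∀ (F G : EuclideanSpace ℝ (Fin 3) → EuclideanSpace ℝ (Fin 3)) (d : ℝ), YBound F M → YBound G M →
      YBound (fun y => F y - G y) d → YBound (fun y => Φ F y - Φ G y) (d / 2)) :
    ∃ F : EuclideanSpace ℝ (Fin 3) → EuclideanSpace ℝ (Fin 3), YBound F M ∧ Φ F = F := by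
  -- the iterates from `0`
  set Fs : ℕ → EuclideanSpace ℝ (Fin 3) → EuclideanSpace ℝ (Fin 3) := fun n => Φ^[n] (fun _ => 0) with hFs
  have h0 : Fs 0 = fun _ => 0 := rfl
  have hsucc : ∀ n, Fs (n + 1) = Φ (Fs n) := fun n => Function.iterate_succ_apply' _ n _
  have hb : ∀ n, YBound (Fs n) M := by
    intro n
    induction n with
    | zero => rw [h0]; exact yBound_zero.mono hM
    | succ n ih => rw [hsucc]; exact hmaps _ ih
  have hd : ∀ n, YBound (fun y => Fs (n + 1) y - Fs n y) (2 * (M / 2) / 2 ^ n) := by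
    intro n
    induction n with
    | zero =>
      have e : (fun y => Fs (0 + 1) y - Fs 0 y) = Fs 1 := by funext y; simp [h0]
      rw [e]
      exact (hb 1).mono (le_of_eq (by ring))
    | succ n ih =>
      have h := hcontr _ _ _ (hb (n + 1)) (hb n) ih
      have e : (fun y => Fs (n + 1 + 1) y - Fs (n + 1) y) = fun y => Φ (Fs (n + 1)) y - Φ (Fs n) y := by
        funext y; rw [hsucc (n + 1), hsucc n]
      rw [e]
      refine h.mono (le_of_eq ?_)
      rw [pow_succ]; ring
  obtain ⟨Flim, hYlim, hYdiff, hFlim, -⟩ := yLimit_of_geometric hb hd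
  refine ⟨Flim, hYlim, funext fun y => ?_⟩
  -- `Φ F_n → Φ F_∞` pointwise (contraction against the geometric tail) and `Φ F_n = F_{n+1} → F_∞`
  have h1 : Tendsto (fun n => Φ (Fs n) y) atTop (𝓝 (Φ Flim y)) := by
    refine tendsto_of_yBound_geometric (c := M) (fun n => ?_) y
    have h := hcontr _ _ _ (hb n) hYlim (hYdiff n)
    exact h.mono (le_of_eq (by ring))
  have h2 : Tendsto (fun n => Φ (Fs n) y) atTop (𝓝 (Flim y)) := by
    have h := (hFlim y).comp (tendsto_add_atTop_nat 1)
    exact h.congr fun n => by simp only [Function.comp_apply, hsucc]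
  exact tendsto_nhds_unique h1 h2

/-- **Uniqueness**: two fixed points of a Y-halving self-map of the ball coincide. -/
theorem yContraction_unique
    (Φ : (EuclideanSpace ℝ (Fin 3) → EuclideanSpace ℝ (Fin 3)) → EuclideanSpace ℝ (Fin 3) → EuclideanSpace ℝ (Fin 3)) {M : ℝ}
    (hcontr : ∀ (F G : EuclideanSpace ℝ (Fin 3) → EuclideanSpace ℝ (Fin 3)) (d : ℝ), YBound F M → YBound G M →
      YBound (fun y => F y - G y) d → YBound (fun y => Φ F y - Φ G y) (d / 2))
    {F G : EuclideanSpace ℝ (Fin 3) → EuclideanSpace ℝ (Fin 3)} (hF : YBound F M) (hG : YBound G M) (hFf : Φ F = F) (hGf : Φ G = G) :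
    F = G := by
  -- `Y(F − G) ≤ (M + M)/2ⁿ` for every `n`
  have hn : ∀ n : ℕ, YBound (fun y => F y - G y) ((M + M) * (1 / 2) ^ n) := by
    intro n
    induction n with
    | zero => simpa using hF.sub hG
    | succ n ih =>
      have h := hcontr F G _ hF hG ih
      rw [hFf, hGf] at h
      refine h.mono (le_of_eq ?_)
      rw [pow_succ]; ring
  funext y
  have ht : Tendsto (fun _ : ℕ => F y) atTop (𝓝 (G y)) := tendsto_of_yBound_geometric (Fs := fun _ => F) hn y
  exact tendsto_nhds_unique tendsto_const_nhds ht

end Summit.NavierStokesRegularity.NavierStokesRegularity.Theorems.KelvinGate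

end
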